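import Summits.ResolutionOfSingularities.ResolutionOfSingularities.Theorems.ValuativeLupiLaurentBase
import Literature.AlgebraicGeometry.Resolution.ResolutionLU
import HarnessLib

/-!
# Route `Valuative`, item `Lupi` (stmt-ResolutionOfSingularities-0560): the constant case `t ^ p ∈ k`

If the Zariski hypersurface `t ^ p = f(x)` has CONSTANT right-hand side `f = c ∈ k`, then
`K = k(x, t) = k'(x)` is purely transcendental over the field `k' = k(t) = k[t]` (finite, purely
inseparable over `k` when `c ∉ k^p`), every valuation ring `O ⊇ k` of `K` contains `k'`
(valuation rings are integrally closed), and the Laurent base over `k'` uniformizes: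
`A := k[t][y] = k'[y] ⊆ O` (`yᵢ ∈ {xᵢ, xᵢ⁻¹}` adapted to `O`) is a polynomial ring over the
field `k'`, hence regular at the centre of `O` — although for imperfect `k` and `c ∉ k^p` it is
nowhere smooth, indeed not geometrically reduced, over `k` (the item rightly asks for REGULAR
models only; cf. the barrier `Literature.Barriers.ResolutionOfSingularities.InseparableBaseChange`).

* `isLocallyUniformizable_of_pow_mem_range` — the conclusion of `Lupi` for every `n`, `p`, `k`,
  `O` when `t ^ p ∈ k`.

So a counterexample to `Lupi` needs `f ∉ k` (besides `n ≥ 4`, `t ∉ k(x)`: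
`ValuativeLupi.lean`).

Log: (1) direct from `ValuativeLupiLaurentBase.lean` over the base field `k(t)`.
-/

-- single-problem summit: the doubled namespace component `ResolutionOfSingularities` is forced
set_option linter.dupNamespace false

open IsLocalRing

namespace Summit.ResolutionOfSingularities.ResolutionOfSingularities.Theorems.Lupi

open Literature.AlgebraicGeometry.Resolution
open scoped IntermediateField

variable {k K : Type} [Field k] [Field K] [Algebra k K]

-- adapted from Cruxes/LuAlphaPTorsor/Disproof.lean (§Helpers)
/-- Valuation rings are integrally closed, in the only form needed: `t ^ n ∈ O ⇒ t ∈ O`. -/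
theorem mem_of_pow_mem (O : ValuationSubring K) {t : K} {n : ℕ} (hn : n ≠ 0) (h : t ^ n ∈ O) :
    t ∈ O := by
  rw [← O.valuation_le_one_iff] at h ⊢
  rw [map_pow] at h
  by_contra hlt
  exact (one_lt_pow₀ (lt_of_not_ge hlt) hn).not_ge h

/-- `k[t] ⊆ O` for `t ∈ O ⊇ k`. -/
theorem adjoin_singleton_le (O : ValuationSubring K) (hO : ∀ c : k, algebraMap k K c ∈ O)
    {t : K} (htO : t ∈ O) {z : K} (hz : z ∈ Algebra.adjoin k ({t} : Set K)) : z ∈ O := by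
  let Oalg : Subalgebra k K := { O.toSubring with algebraMap_mem' := hO }
  have h : Algebra.adjoin k ({t} : Set K) ≤ Oalg :=
    Algebra.adjoin_le (Set.singleton_subset_iff.mpr htO)
  exact h hz

/-- **The constant case of `Lupi`.** If `x` is algebraically independent over `k`,
`t ^ p = c ∈ k` (`p ≠ 0`) and `K = k(x, t)`, then every valuation ring `O ⊇ k` of `K` is locally
uniformizable over `k`: the model is `k[t][y]`, a polynomial ring over the field `k[t]`. -/
theorem isLocallyUniformizable_of_pow_mem_range {n : ℕ} (x : Fin n → K) (t : K) {p : ℕ}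
    (hp : p ≠ 0) (hx : AlgebraicIndependent k x) (htk : t ^ p ∈ (algebraMap k K).range)
    (htop : IntermediateField.adjoin k (insert t (Set.range x)) = ⊤)
    (O : ValuationSubring K) (hO : ∀ c : k, algebraMap k K c ∈ O) :
    IsLocallyUniformizable k K O := by
  classical
  obtain ⟨c, hc⟩ := htk
  -- `t` is integral over `k`, `k' := k(t) = k[t]` is a field, finite over `k`, inside `O`
  have htint : IsIntegral k t := by
    refine ⟨Polynomial.X ^ p - Polynomial.C c, Polynomial.monic_X_pow_sub_C c hp, ?_⟩
    simp [hc]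
  set k' : IntermediateField k K := k⟮t⟯ with hk'
  haveI : FiniteDimensional k k' := IntermediateField.adjoin.finiteDimensional htint
  have hk'alg : k'.toSubalgebra = Algebra.adjoin k ({t} : Set K) :=
    IntermediateField.adjoin_simple_toSubalgebra_of_isAlgebraic htint.isAlgebraic
  have htO : t ∈ O := mem_of_pow_mem O hp (hc ▸ hO c)
  have hmemk' : ∀ z : K, z ∈ k' → z ∈ Algebra.adjoin k ({t} : Set K) := fun z hz => by
    change z ∈ k'.toSubalgebra at hz
    rwa [hk'alg] at hz
  have hO' : ∀ c' : k', algebraMap k' K c' ∈ O := fun c' =>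
    adjoin_singleton_le O hO htO (hmemk' _ c'.2)
  -- `K = k'(x)` and `x` is algebraically independent over `k'`
  haveI : FaithfulSMul k' K :=
    (faithfulSMul_iff_algebraMap_injective k' K).mpr (algebraMap k' K).injective
  have htop' : IntermediateField.adjoin k' (Set.range x) = ⊤ := by
    apply IntermediateField.restrictScalars_injective k
    rw [IntermediateField.restrictScalars_top, hk', IntermediateField.adjoin_adjoin_left,
      Set.singleton_union, htop]
  have halg' : Algebra.IsAlgebraic (Algebra.adjoin k' (Set.range x)) K :=
    ⟨fun a => isAlgebraic_adjoin_of_mem_adjoin (by rw [htop']; exact IntermediateField.mem_top)⟩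
  have hx' : AlgebraicIndependent k' x := by
    haveI := halg'
    refine (Algebra.IsAlgebraic.isTranscendenceBasis_of_le_trdeg_of_finite k' x ?_).1
    have h2 : Algebra.trdeg k k' + Algebra.trdeg k' K = Algebra.trdeg k K :=
      trdeg_add_eq k k' (A := K)
    rw [trdeg_eq_zero, zero_add] at h2
    rw [h2]
    exact hx.cardinalMk_le_trdeg
  -- the Laurent base over `k'`
  obtain ⟨y, hyO, hy⟩ := exists_eq_or_eq_inv_mem O x
  have hyind : AlgebraicIndependent k' y := algebraicIndependent_of_eq_or_eq_inv hx' halg' hy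
  have hS : (Algebra.adjoin k' (Set.range y)).toSubring ≤ O.toSubring :=
    adjoin_range_toSubring_le O hO' hyO
  have hregS := isRegularLocalRing_centre_adjoin_range O hyind hS
  -- the same ring as a `k`-subalgebra: `A = k[t][y]`
  set A : Subalgebra k K := Algebra.adjoin k (insert t (Set.range y)) with hA
  have hyA : ∀ i, y i ∈ A := fun i => Algebra.subset_adjoin (Set.mem_insert_of_mem _ ⟨i, rfl⟩)
  have htA : t ∈ A := Algebra.subset_adjoin (Set.mem_insert _ _)
  have htk' : t ∈ k' := IntermediateField.mem_adjoin_simple_self k t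
  have hAB : A ≤ (Algebra.adjoin k' (Set.range y)).restrictScalars k := by
    refine Algebra.adjoin_le (Set.insert_subset_iff.mpr ⟨?_, ?_⟩)
    · show t ∈ (Algebra.adjoin k' (Set.range y)).restrictScalars k
      rw [Subalgebra.mem_restrictScalars]
      have ht' : algebraMap k' K ⟨t, htk'⟩ ∈ Algebra.adjoin k' (Set.range y) :=
        Subalgebra.algebraMap_mem _ _
      exact ht'
    · rintro _ ⟨i, rfl⟩
      show y i ∈ (Algebra.adjoin k' (Set.range y)).restrictScalars k
      rw [Subalgebra.mem_restrictScalars]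
      exact Algebra.subset_adjoin ⟨i, rfl⟩
  have hBA : ∀ z : K, z ∈ Algebra.adjoin k' (Set.range y) → z ∈ A := by
    intro z hz
    induction hz using Algebra.adjoin_induction with
    | mem w hw =>
      obtain ⟨i, rfl⟩ := hw
      exact hyA i
    | algebraMap c' =>
      show (c' : K) ∈ A
      exact Algebra.adjoin_mono (Set.singleton_subset_iff.mpr (Set.mem_insert _ _))
        (hmemk' _ c'.2)
    | add _ _ _ _ ha hb => exact add_mem ha hb
    | mul _ _ _ _ ha hb => exact mul_mem ha hb
  have e : A.toSubring = (Algebra.adjoin k' (Set.range y)).toSubring :=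
    le_antisymm (fun z hz => hAB hz) (fun z hz => hBA z hz)
  have hAO : A.toSubring ≤ O.toSubring := e ▸ hS
  refine ⟨A, hAO, ?_, ?_, isRegularLocalRing_centre_of_toSubring_eq O A hAO hS e hregS⟩
  · refine ⟨insert t (Finset.univ.image y), ?_⟩
    rw [Finset.coe_insert, Finset.coe_image, Finset.coe_univ, Set.image_univ]
  · apply isFractionRing_of_adjoin_eq_top
    apply top_le_iff.mp
    set F := IntermediateField.adjoin k ((A : Subalgebra k K) : Set K) with hF
    have hAF : ∀ z ∈ A, z ∈ F := fun z hz => IntermediateField.subset_adjoin k _ hz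
    rw [← htop, IntermediateField.adjoin_le_iff]
    rintro z (rfl | ⟨i, rfl⟩)
    · exact hAF _ htA
    · exact mem_of_eq_or_eq_inv hy (fun j => hAF _ (hyA j)) i

end Summit.ResolutionOfSingularities.ResolutionOfSingularities.Theorems.Lupi
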